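import Literature.MathematicalPhysics.QuantumFieldTheory.Balaban1983to89.Node00.CarriersB6K
import Literature.MathematicalPhysics.QuantumFieldTheory.Balaban1983to89.B8ScaledSupNorm
import Literature.MathematicalPhysics.QuantumFieldTheory.Balaban1983to89.B6Prop26Census2139KLevelV1
import Literature.MathematicalPhysics.QuantumFieldTheory.Balaban1983to89.B9

/-!
# `Balaban1983to89.B9GeoNormsKLevelV1` — T. Bałaban, *Propagators for lattice gauge theories in a background field*, Commun. Math. Phys.
# **99** (1985) 389–434 [Balaban1985BackgroundPropagators], Sect. A p. 397, (3.39)–(3.41) and «Δ(y) = B^j(y), Δ̃(y)»: THE NORM VOCABULARY OF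
# SECT. A AND THE Δ̃-SUPPORT PREDICATES READ ON A MEMBER OF THE GENUINE k-LEVEL V1 TORUS INDEX (the 𝐃_k-coordinate of the Stage-3′(Y) geometry
# layer), and the `B9.Geometry` READING `geo9K i` of that member with its dictionary to the [B6] tower geometry `Node00.kGeoU i`

statement-level skeleton of published theorems with citation tags; proofs where landed; nothing here is a claim about the Yang–Mills mass gap

PRINT, AS PRINTED (held text `paper:balaban1985-cmp99-background-propagators`, p. 397 [PDF 9]): «the supremum norms |A| = max_μ sup_x |A_μ(x)|, |∇A| =
max_{μ,ν} sup_x |(D_μA_ν)(x)| (3.39)», the Hölder norms (3.40) (parallel transport `R(U(Γ_{x,x′}))` over pairs `|x − x′| ≤ 1`; «It is understood that the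
η-scale is used in the above definitions. If we use another scale, then it is indicated explicitly by a superscript»), «|A|_{(α)} = sup_j sup_{b ∈ Ω_j∖Ω_{j+1}}
(Lʲη)^{−α}|A(b)| (3.41). Thus the norm |A|_{(α)} can be defined as the smallest number C such, that |A(b)| ≤ C(Lʲη)^α for b ∈ Ω_j∖Ω_{j+1}, j = 0, 1, …, k»,
«if y ∈ Λ_j, then Δ(y) = B^j(y), and Δ̃(y) is a cube of the size 2Lʲη on the lattice T_η with center at the point y».

CITATION HEADER (lean-in-tree rule) — WHAT IS REPRODUCED.  Cell `pub-ymgap`, seat `pub-ymgap-dag-n03-b` (g2) as the typing HAND of the interim definer of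
the Stage-3′(Y) GEOMETRY∕INDEX layer (seat dag-n06-a, «def-Y»; director LINE №32; design `HOME/pub-ymgap-dag-n06-a/B9-PIN-DESIGN-g2.md` v1.5 §6∕§7:
«`geo9` = a READING of `Node00.kGeoU` extended by the Δ̃-support predicates and the weighted norm (3.41)»), share «(3.39)–(3.41) norm vocabulary +
Δ̃-support reading» (INBOX [N03B-G2-DECL-LIST-1]).  A Literature-side CARRIER module: definitions with bodies + dictionary ∕ non-degeneracy lemmas; NO
stage predicate, NO `Admissible`∕`Record` object, no `instance`, no `notation`.  REUSED BY NAME, restating nothing: r03's index `B6KLevelCensusIndexV1.KIdx`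
and readings `kGeo`∕`kGeoG`, node00-def's unified `Node00.kGeoU` ∕ `KLoc` ∕ `KCut` ∕ `toKT`, p21's torus geometry `B6Geom246MultiLevelTorus.geomT`
(blocks `𝔅`, distance (2.46)), r05's multi-scale weighted sup norm `B8ScaledSupNorm.msup` ∕ `weight` (print's [B8] p. 86 recall of (3.41)), the
abstract carrier `B9.Geometry` (b2b r1 ∕ b09, fields `suppIn`∕`suppInT`∕`wNorm`∕`cutIn`∕`cutInT` …).
* §1 (3.41) — `wNormB i γ J` (fine-bond functions: `msup` with membership «the block of the bond has level j», i.e. «b ∈ Ω_j∖Ω_{j+1}», weights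
  `(Lʲ·|c_f|⁻¹)^{−γ}`), `wNormS i γ f` (torus-site functions, T8's (2.67) reading), `wNormU i γ : KLoc i → ℝ`; API: boundedness on the finite torus
  (`bddB`, `bddS`), `wNormB_nonneg`, the two directions of print's «smallest C» sentence (`abs_le_of_wNormB_le`, `wNormB_le_of_pointwise`),
  `weight_mul_abs_le_wNormB`.
* §2 Δ̃-SUPPORT — `suppNear i J y′` («supp J ⊂ Δ̃(y′)» READ AS: every fine bond where `J ≠ 0` lies in a block within torus distance 1 of `y′` — the SAME
  reading r03's census uses for cut-offs, `kGeoG.cutIn`), `suppNearS` (sites), `suppNearU` (both summands, at the carrier block `β c`), and Δ ⊂ Δ̃: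
  `suppNear_of_suppIn`, `suppNearU_of_suppIn`.
* §3 `geo9K i : B9.Geometry` — the [B9] Sect. A geometry READING OF RECORD of the member (def-Y's word, Q1 → (W)): every [B6] field from `Node00.kGeoU i`,
  `wNorm := wNormU i`, `cutInT := (kGeoU i).cutIn` (already Δ̃-wide), **`suppInT := (kGeoU i).suppIn` (ONE block — located, weaker than print's Δ̃(y′) at
  (3.44)∕(3.45)∕(3.133); GAPS G-B6-2138-SUPP inherited from N03)**; `geo9KT i` = the Δ̃-faithful variant (`suppInT := suppNearU i`), ONE FIELD apart, ready
  for the swap when the (c3) Δ̃-extension of the k-level census lands.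
* §4 DICTIONARY vs `kGeoU i` — the GEOMETRY half of `B9FromB6.DictAtOne` with `site∕loc∕cut := id`: `M`, `len`, `dist`, the norms and cut-off
  functionals agree by `rfl`; `supp`, `suppT`, `cutIn`, `cutT` are identities for `geo9K`.  **LOCATED (R443 (c3) consumer rule, N06 = the first consumer):
  under the Δ̃-faithful `geo9KT` the field `DictAtOne.suppT : g.suppInT lam y → g₆.suppIn (loc lam) (site y)` is NOT an identity** — `kGeoU`'s ARGUMENT
  predicate is ONE block (cell GAPS G-B6-2138-SUPP), so there `suppT` is exactly the consumer-owed Δ̃-extension of N03's census (2.138)∕(2.139) (seat HANDOFF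
  §4; `not_suppIn_of_ne` is the witness shape).
* §6 SIGN FACTS of the reading (the fields of `B9FromB6.ModelSigns` that hold for `geo9K`: `L, η, dist, supNorm, l2Norm, wNorm, holder, cutH, cutSup ≥ 0` on
  both summands; `holder_mono` on the FINE-BOND summand by r03's `holder_mono_exponent` — on the SITE summand T8's all-pairs `hqTP` is NOT monotone in the
  exponent (seat note [N03B-G2-HAZARD-1]: print's (3.40) takes `|x − x′| ≤ 1` only), so `ModelSigns (geo9K i)` itself is NOT claimed).
* §5 NON-DEGENERACY (∀-form predicates, R437): `suppNear_zero`, `not_suppNear_of_two_le_dist` (a function non-zero on a bond whose block is at torus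
  distance ≥ 2 from `y′` is not Δ̃(y′)-supported — the block is DATA, no ∃ over free data), `wNormB_zero` (`J = 0`).
HONEST SCOPE.  (1) READINGS, located: Δ̃(y′) as «blocks within d_T ≤ 1 of y′» contains print's cube of size 2Lʲη centred at y′ (as a HYPOTHESIS class on
arguments this is print-strength or stronger); the bond's level is the level of the block of its source site (r03's `blkV1`); (3.41)'s `η` is `|c_f|⁻¹`
(`= L^{−k}` on the index of record `KRIdx`).  (2) NOT HERE: (3.40) WITH parallel transport at a general background `U` (the abstract `B9.Geometry.holder` has
no `U` slot; the background enters `B9.KernelFamily` through `B.Cfg`) — `geo9K.holder` is the U = 1 census functional of r03 (`kGeoU.holder`); the covariant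
(3.40) on the torus of record belongs to the background∕operator layer (ℤᵈ version: `B9Eq340HolderZd`).  (3) The [B9]-pinning datum `Y` does not occur: the
Sect. A geometry at the η-scale is `Y`-independent by content (rail (iii) binds the operator∕background carriers).  (4) Count-neutral supply for N06's
frame; nothing of [B9]'s estimates asserted; nothing on d = 4 or the continuum; NOT summit progress.  Unit `pub-ymgap-dag-n03-b` (gen 2), 2026-08-26.
-/

noncomputable section

namespace Literature.MathematicalPhysics.QuantumFieldTheory.Balaban1983to89.B9GeoNormsKLevelV1

open LatticeFieldCalculus
open B6SectAOperatorsV1 (BondIdx)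
open B6GlobalChartV1 (PV domT blkV1)
open B6Geom246MultiLevelBox (bset blkOf scale_bounds)
open B6Geom246MultiLevelTorus (geomT)
open B6Ineq2142KLevelV1 (lvl β)
open B6KLevelCensusIndexV1 (KIdx kGeo kGeoG)
open B6Prop22KLevelTorusCensus (KTIdx)
open B6Prop22KLevelTorusCensusEta (geoTP hqTP hqTP_nonneg)
open B6Prop26Census2139KLevelV1 (holder_mono_exponent)
open B8ScaledSupNorm (weight msup Bdd msup_le msup_nonneg weight_mul_norm_le_msup norm_le_of_msup_le msup_le_of_pointwise weight_zero)
open Node00 (kGeoU KLoc KCut toKT)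

variable {d ℓ : ℕ} {hd : 1 ≤ d + 1} {hL : Odd (ℓ + 1) ∧ 1 < ℓ + 1} {b₀ b₁ : ℝ}

/-! ## §1  The weighted supremum norm (3.41) on fine-bond functions, on torus-site functions, and on the sum type `KLoc` -/

/-- **(3.41) on FINE-BOND functions**: `|J|_{(γ)} = sup_j sup_{b : level(b) = j} (Lʲ·|c_f|⁻¹)^{−γ}|J(b)|` — r05's `msup` with the membership «the block of the
bond `b` has level `j`» (= «b ∈ Ω_j∖Ω_{j+1}» for the V1 torus family: the level of a fine bond is the level of the block of its source site).
[cite: Balaban1985BackgroundPropagators, (3.41) p.397] -/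
def wNormB (i : KIdx d ℓ hd hL b₀ b₁) (γ : ℝ) (J : PBond (PV d ℓ i.m i.K hd hL) 0 → ℝ) : ℝ :=
  msup (ℓ + 1) i.k |i.cf|⁻¹ γ (fun j (x : PBond (PV d ℓ i.m i.K hd hL) 0) => (blkV1 i.hN i.D x).1.1 = j) J

/-- **(3.41) on torus-SITE functions** (the arguments `λ` of the (2.67)∕Thm 3.1 reading, T8's `KTIdx` carrier): membership «the block of the site has level `j`».
[cite: Balaban1985BackgroundPropagators, (3.41) p.397] -/
def wNormS (i : KIdx d ℓ hd hL b₀ b₁) (γ : ℝ) (f : ↥(toKT i).XB → ℝ) : ℝ :=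
  msup (ℓ + 1) i.k |i.cf|⁻¹ γ (fun j (x : ↥(toKT i).XB) => (blkOf i.D.toDomains x).1.1 = j) f

/-- **(3.41) on the SUM-typed arguments `KLoc i`** of the unified geometry `Node00.kGeoU` (site functions ∕ fine-bond functions).
[cite: Balaban1985BackgroundPropagators, (3.41) p.397] -/
def wNormU (i : KIdx d ℓ hd hL b₀ b₁) (γ : ℝ) : KLoc i → ℝ := fun lam =>
  match lam with
  | .inl f => wNormS i γ f
  | .inr J => wNormB i γ J

/-- the level of the block of a fine bond is at most `k`. [cite: Balaban1984PropagatorsII, (2.1)–(2.4) p.224, dictionary] -/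
theorem blkV1_level_le (i : KIdx d ℓ hd hL b₀ b₁) (x : PBond (PV d ℓ i.m i.K hd hL) 0) : (blkV1 i.hN i.D x).1.1 ≤ i.k :=
  (scale_bounds i.D.toDomains (blkV1 i.hN i.D x)).2

/-- the level of the block of a torus site is at most `k`. [cite: Balaban1984PropagatorsII, (2.1)–(2.4) p.224, dictionary] -/
theorem blkOf_level_le (i : KIdx d ℓ hd hL b₀ b₁) (x : ↥(toKT i).XB) : (blkOf i.D.toDomains x).1.1 ≤ i.k :=
  (scale_bounds i.D.toDomains (blkOf i.D.toDomains x)).2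

/-- on the FINITE torus the weighted family of (3.41) is bounded (print's suprema are maxima). [cite: Balaban1985BackgroundPropagators, (3.41) p.397, bookkeeping] -/
theorem bddB (i : KIdx d ℓ hd hL b₀ b₁) (γ : ℝ) (J : PBond (PV d ℓ i.m i.K hd hL) 0 → ℝ) :
    Bdd (ℓ + 1) i.k |i.cf|⁻¹ γ (fun j (x : PBond (PV d ℓ i.m i.K hd hL) 0) => (blkV1 i.hN i.D x).1.1 = j) J := by
  classical
  refine ⟨∑ x : PBond (PV d ℓ i.m i.K hd hL) 0, weight (ℓ + 1) |i.cf|⁻¹ γ (blkV1 i.hN i.D x).1.1 * ‖J x‖, fun j _ x hx => ?_⟩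
  rw [← hx]
  exact Finset.single_le_sum (f := fun x => weight (ℓ + 1) |i.cf|⁻¹ γ (blkV1 i.hN i.D x).1.1 * ‖J x‖)
    (fun x _ => mul_nonneg (B8ScaledSupNorm.weight_nonneg _ (inv_nonneg.2 (abs_nonneg _)) _ _) (norm_nonneg _)) (Finset.mem_univ x)

/-- likewise for torus-site functions. [cite: Balaban1985BackgroundPropagators, (3.41) p.397, bookkeeping] -/
theorem bddS (i : KIdx d ℓ hd hL b₀ b₁) (γ : ℝ) (f : ↥(toKT i).XB → ℝ) :
    Bdd (ℓ + 1) i.k |i.cf|⁻¹ γ (fun j (x : ↥(toKT i).XB) => (blkOf i.D.toDomains x).1.1 = j) f := by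
  classical
  refine ⟨∑ x : ↥(toKT i).XB, weight (ℓ + 1) |i.cf|⁻¹ γ (blkOf i.D.toDomains x).1.1 * ‖f x‖, fun j _ x hx => ?_⟩
  rw [← hx]
  exact Finset.single_le_sum (f := fun x => weight (ℓ + 1) |i.cf|⁻¹ γ (blkOf i.D.toDomains x).1.1 * ‖f x‖)
    (fun x _ => mul_nonneg (B8ScaledSupNorm.weight_nonneg _ (inv_nonneg.2 (abs_nonneg _)) _ _) (norm_nonneg _)) (Finset.mem_univ x)

/-- `0 ≤ |J|_{(γ)}`. [cite: Balaban1985BackgroundPropagators, (3.41) p.397, bookkeeping] -/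
theorem wNormB_nonneg (i : KIdx d ℓ hd hL b₀ b₁) (γ : ℝ) (J : PBond (PV d ℓ i.m i.K hd hL) 0 → ℝ) : 0 ≤ wNormB i γ J :=
  msup_nonneg _ _ (inv_nonneg.2 (abs_nonneg _)) _ _ _

/-- `0 ≤ |f|_{(γ)}`. [cite: Balaban1985BackgroundPropagators, (3.41) p.397, bookkeeping] -/
theorem wNormS_nonneg (i : KIdx d ℓ hd hL b₀ b₁) (γ : ℝ) (f : ↥(toKT i).XB → ℝ) : 0 ≤ wNormS i γ f :=
  msup_nonneg _ _ (inv_nonneg.2 (abs_nonneg _)) _ _ _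

/-- `0 ≤ |·|_{(γ)}` on `KLoc`. [cite: Balaban1985BackgroundPropagators, (3.41) p.397, bookkeeping] -/
theorem wNormU_nonneg (i : KIdx d ℓ hd hL b₀ b₁) (γ : ℝ) (lam : KLoc i) : 0 ≤ wNormU i γ lam := by
  cases lam with
  | inl f => exact wNormS_nonneg i γ f
  | inr J => exact wNormB_nonneg i γ J

/-- each weighted value is below the norm: `(L^{j(b)}|c_f|⁻¹)^{−γ}|J(b)| ≤ |J|_{(γ)}`. [cite: Balaban1985BackgroundPropagators, (3.41) p.397] -/
theorem weight_mul_abs_le_wNormB (i : KIdx d ℓ hd hL b₀ b₁) (γ : ℝ) (J : PBond (PV d ℓ i.m i.K hd hL) 0 → ℝ) (x : PBond (PV d ℓ i.m i.K hd hL) 0) :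
    weight (ℓ + 1) |i.cf|⁻¹ γ (blkV1 i.hN i.D x).1.1 * |J x| ≤ wNormB i γ J :=
  weight_mul_norm_le_msup (bddB i γ J) (blkV1_level_le i x) rfl

/-- **print's pointwise form, forward**: `|J|_{(γ)} ≤ C` gives `|J(b)| ≤ C·(L^{j(b)}|c_f|⁻¹)^γ` on every fine bond («the smallest number C such that
|A(b)| ≤ C(Lʲη)^α»). [cite: Balaban1985BackgroundPropagators, (3.41) p.397] -/
theorem abs_le_of_wNormB_le (i : KIdx d ℓ hd hL b₀ b₁) {γ C : ℝ} {J : PBond (PV d ℓ i.m i.K hd hL) 0 → ℝ} (hC : wNormB i γ J ≤ C)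
    (x : PBond (PV d ℓ i.m i.K hd hL) 0) : |J x| ≤ C * ((((ℓ + 1 : ℕ) : ℝ)) ^ (blkV1 i.hN i.D x).1.1 * |i.cf|⁻¹) ^ γ := by
  have h := norm_le_of_msup_le (Nat.succ_pos ℓ) (inv_pos.2 (abs_pos.2 i.hcf)) (bddB i γ J) hC (blkV1_level_le i x) rfl
  simpa using h

/-- **print's pointwise form, backward**: `|J(b)| ≤ C·(L^{j(b)}|c_f|⁻¹)^γ` on every fine bond (`C ≥ 0`) gives `|J|_{(γ)} ≤ C`.
[cite: Balaban1985BackgroundPropagators, (3.41) p.397] -/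
theorem wNormB_le_of_pointwise (i : KIdx d ℓ hd hL b₀ b₁) {γ C : ℝ} {J : PBond (PV d ℓ i.m i.K hd hL) 0 → ℝ} (hC : 0 ≤ C)
    (h : ∀ x : PBond (PV d ℓ i.m i.K hd hL) 0, |J x| ≤ C * ((((ℓ + 1 : ℕ) : ℝ)) ^ (blkV1 i.hN i.D x).1.1 * |i.cf|⁻¹) ^ γ) : wNormB i γ J ≤ C := by
  refine msup_le_of_pointwise (Nat.succ_pos ℓ) (inv_pos.2 (abs_pos.2 i.hcf)) hC fun j _ x hx => ?_
  have := h x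
  rw [hx] at this
  simpa using this

/-- **(3.41) at `γ = 0` IS (3.39)**: `|J|_{(0)} ≤ C ↔` every `|J(b)| ≤ C` (`C ≥ 0`): the weight is `1`. [cite: Balaban1985BackgroundPropagators, (3.39), (3.41) p.397] -/
theorem wNormB_zero_le_iff (i : KIdx d ℓ hd hL b₀ b₁) {C : ℝ} (hC : 0 ≤ C) (J : PBond (PV d ℓ i.m i.K hd hL) 0 → ℝ) :
    wNormB i 0 J ≤ C ↔ ∀ x, |J x| ≤ C := by
  constructor
  · intro h x
    simpa [Real.rpow_zero] using abs_le_of_wNormB_le i h x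
  · intro h
    exact wNormB_le_of_pointwise i hC fun x => by simpa [Real.rpow_zero] using h x

/-! ## §2  The Δ̃-support predicates -/

/-- **«supp J ⊂ Δ̃(y′)» READ ON THE V1 TORUS**: every fine bond where `J ≠ 0` lies in a block within torus distance `1` of the block `y′` (the same
reading r03's census uses for the cut-offs, `kGeoG.cutIn`; it contains print's cube of size `2Lʲη` centred at `y′`).
[cite: Balaban1985BackgroundPropagators, p.397 («Δ̃(y) is a cube of the size 2Lʲη … with center at the point y»), (3.44)–(3.45) p.398] -/
def suppNear (i : KIdx d ℓ hd hL b₀ b₁) (J : PBond (PV d ℓ i.m i.K hd hL) 0 → ℝ) (y' : (geomT i.D).Site) : Prop :=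
  ∀ x, J x ≠ 0 → (geomT i.D).dist (blkV1 i.hN i.D x) y' ≤ 1

/-- the same for torus-site functions (blocks of sites). [cite: Balaban1985BackgroundPropagators, p.397 (Δ̃(y))] -/
def suppNearS (i : KIdx d ℓ hd hL b₀ b₁) (f : ↥(toKT i).XB → ℝ) (y' : (geomT i.D).Site) : Prop :=
  ∀ x, f x ≠ 0 → (geomT i.D).dist (blkOf i.D.toDomains x) y' ≤ 1

/-- **«supp ⊂ Δ̃(y′)» on the SUM-typed arguments**, read at the carrier block `β c` of the index bond `c` (as `Node00.kGeoU.suppIn` reads Δ).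
[cite: Balaban1985BackgroundPropagators, p.397 (Δ̃(y)), (3.44)–(3.45) p.398] -/
def suppNearU (i : KIdx d ℓ hd hL b₀ b₁) : KLoc i → (kGeoU i).Site → Prop := fun lam c =>
  match lam with
  | .inl f => suppNearS i f (β i.hN i.D i.hk c)
  | .inr J => suppNear i J (β i.hN i.D i.hk c)

section Incl

variable (i : KIdx d ℓ hd hL b₀ b₁)

/-- the torus distance of a block to itself is `0` (p21). [cite: Balaban1984PropagatorsII, (2.46) p.231] -/
theorem distT_self (y : (geomT i.D).Site) : (geomT i.D).dist y y = 0 :=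
  (B6Geom246MultiLevelTorus.triangle_refl_nonneg_T i.D (le_trans (by norm_num) i.hM8) (fun μ => le_trans (by norm_num) (i.hP5 μ))).2.1 y

/-- **Δ(y′) ⊂ Δ̃(y′)** for fine-bond functions: r03's one-block support implies the Δ̃-support. [cite: Balaban1985BackgroundPropagators, p.397 (Δ(y) = B^j(y) ⊂ Δ̃(y))] -/
theorem suppNear_of_suppIn {J : PBond (PV d ℓ i.m i.K hd hL) 0 → ℝ} {y' : (geomT i.D).Site} (h : (kGeoG i).suppIn J y') : suppNear i J y' := by
  intro x hx
  rw [h x hx, distT_self]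
  exact zero_le_one

/-- **Δ(y′) ⊂ Δ̃(y′)** for torus-site functions. [cite: Balaban1985BackgroundPropagators, p.397 (Δ(y) ⊂ Δ̃(y))] -/
theorem suppNearS_of_suppIn {f : ↥(toKT i).XB → ℝ} {y' : (geomT i.D).Site}
    (h : ∀ x, f x ≠ 0 → blkOf i.D.toDomains x = y') : suppNearS i f y' := by
  intro x hx
  rw [h x hx, distT_self]
  exact zero_le_one

/-- **Δ ⊂ Δ̃ on the sum type**: `(kGeoU i).suppIn lam c → suppNearU i lam c`. [cite: Balaban1985BackgroundPropagators, p.397 (Δ(y) ⊂ Δ̃(y))] -/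
theorem suppNearU_of_suppIn (lam : KLoc i) (c : (kGeoU i).Site) (h : (kGeoU i).suppIn lam c) : suppNearU i lam c := by
  cases lam with
  | inl f => exact suppNearS_of_suppIn i h
  | inr J => exact suppNear_of_suppIn i h

end Incl

/-! ## §3  The `B9.Geometry` reading of a member of the k-level V1 index -/

/-- **THE [B9] SECT. A GEOMETRY OF A k-LEVEL V1 MEMBER — THE READING OF RECORD FOR THE Stage-3′(Y) PIN** (def-Y's word [DEFY-G3-WORD-ON-N03B-DECL-LIST-1],
Q1 → (W)): every [B6] field from node00-def's unified `Node00.kGeoU i` (sites = index bonds, `scale = level`, `dist = d_T` of the carrier blocks, `η = |c_f|⁻¹`,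
`M = L·M_h`, SUM-typed arguments and cut-offs, the U = 1 norm functionals), `wNorm :=` (3.41) `wNormU i`, `cutInT := (kGeoU i).cutIn` (r03's cut-off class is
already «within d_T ≤ 1», i.e. Δ̃-wide), and **`suppInT := (kGeoU i).suppIn` (ONE block)** so that `B9FromB6.DictAtOne.suppT` is an identity and N06's U = 1 base
closes BY NAME from N03's block today.  LOCATED: at this reading (3.44)∕(3.45)∕(3.133) are typed with supp λ ⊂ Δ(y′) — weaker than print's Δ̃(y′); cell GAPS
G-B6-2138-SUPP inherited from N03 (R443 (c3)); swap the one field to `suppNearU i` (`geo9KT`, below) when the (c3) Δ̃-extension of the k-level census lands.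
[cite: Balaban1985BackgroundPropagators, Sect. A (3.39)–(3.41) p.397, p.397 (Δ, Δ̃); (3.44)–(3.45) p.398 (located reading)] -/
def geo9K (i : KIdx d ℓ hd hL b₀ b₁) : B9.Geometry where
  Site := (kGeoU i).Site
  scale := (kGeoU i).scale
  dist := (kGeoU i).dist
  k := (kGeoU i).k
  eta := (kGeoU i).eta
  L := (kGeoU i).L
  M := (kGeoU i).M
  Loc := (kGeoU i).Loc
  suppIn := (kGeoU i).suppIn
  suppInT := (kGeoU i).suppIn
  supNorm := (kGeoU i).supNorm
  l2Norm := (kGeoU i).l2Norm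
  wNorm := wNormU i
  holder := (kGeoU i).holder
  Cut := (kGeoU i).Cut
  cutIn := (kGeoU i).cutIn
  cutInT := (kGeoU i).cutIn
  cutH := (kGeoU i).cutH
  cutSup := (kGeoU i).cutSup
  suppInT_of_suppIn := fun _ _ h => h
  cutInT_of_cutIn := fun _ _ h => h

/-- **THE Δ̃-FAITHFUL VARIANT, READY FOR THE SWAP** (Q1 → (S)): `geo9K` with the one field `suppInT := suppNearU i` («supp λ ⊂ Δ̃(y′)» read as «every bond ∕ site
where λ ≠ 0 lies in a block within d_T ≤ 1 of the carrier block»); under it `DictAtOne.suppT` is the consumer-owed Δ̃-extension of N03's (2.138)∕(2.139) (R443 (c3)),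
not an identity. [cite: Balaban1985BackgroundPropagators, p.397 (Δ̃), (3.44)–(3.45) p.398] -/
def geo9KT (i : KIdx d ℓ hd hL b₀ b₁) : B9.Geometry :=
  { geo9K i with
    suppInT := suppNearU i
    suppInT_of_suppIn := suppNearU_of_suppIn i }

section Reading

variable (i : KIdx d ℓ hd hL b₀ b₁)

/-- `geo9K`'s Δ̃-argument predicate IS the one-block `suppIn` (the located reading of record). [cite: Balaban1985BackgroundPropagators, p.397 (Δ ⊂ Δ̃), dictionary] -/
theorem geo9K_suppInT : (geo9K i).suppInT = (kGeoU i).suppIn := rfl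
/-- `geo9KT`'s Δ̃-argument predicate IS `suppNearU` (the swap target). [cite: Balaban1985BackgroundPropagators, p.397 (Δ̃), dictionary] -/
theorem geo9KT_suppInT : (geo9KT i).suppInT = suppNearU i := rfl
/-- the two readings differ in that one field only: same sites, arguments, norms, cut-offs. [cite: Balaban1985BackgroundPropagators, p.397, dictionary] -/
theorem geo9KT_wNorm : (geo9KT i).wNorm = (geo9K i).wNorm := rfl
/-- `geo9K`'s weighted norm IS (3.41) `wNormU` — print's sign convention: `(geo9K i).wNorm γ λ = |λ|_{(γ)} = sup (Lʲη)^{−γ}|λ|`, the functional that the third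
conjunct of `B9.Ineq342_346_347` (`K.glob n U λ γ ≤ B₀·g.wNorm γ λ`, the global entries (3.47) `|Gλ|_{(2+γ)}, |∇Gλ|_{(1+γ)}, …` bounded by `|λ|_{(γ)}`) reads on
the right-hand side. [cite: Balaban1985BackgroundPropagators, (3.41) p.397, (3.47) p.398, dictionary] -/
theorem geo9K_wNorm : (geo9K i).wNorm = wNormU i := rfl
/-- the scale length agrees with the [B6] tower geometry: `(geo9K i).len = (kGeoU i).len`. [cite: Balaban1985BackgroundPropagators, (3.41) p.397 («Lʲη»), dictionary] -/
theorem geo9K_len (c : (kGeoU i).Site) : (geo9K i).len c = (kGeoU i).len c := rfl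
/-- … and with r03's bond-site reading `kGeo`. [cite: Balaban1984PropagatorsII, (2.1) p.224, dictionary] -/
theorem geo9K_len_kGeo (c : (kGeoU i).Site) : (geo9K i).len c = (kGeo i).len c := rfl

end Reading

/-! ## §4  The dictionary to the [B6] tower geometry (`B9FromB6.DictAtOne`, geometry half, with identity maps) -/

section Dict

variable (i : KIdx d ℓ hd hL b₀ b₁)

/-- `M` agrees. [cite: Balaban1985BackgroundPropagators, Cor. 3.5 p.407 (U = 1 is [B6]), dictionary] -/
theorem dict_M_eq : (kGeoU i).M = (geo9K i).M := rfl
/-- `len` agrees (field `len_eq` with `site := id`). [cite: Balaban1985BackgroundPropagators, Cor. 3.5 p.407, dictionary] -/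
theorem dict_len_eq (y : (geo9K i).Site) : (kGeoU i).len y = (geo9K i).len y := rfl
/-- `dist` agrees. [cite: Balaban1985BackgroundPropagators, Cor. 3.5 p.407, dictionary] -/
theorem dict_dist_eq (y y' : (geo9K i).Site) : (kGeoU i).dist y y' = (geo9K i).dist y y' := rfl
/-- field `supp` (Δ ↦ Δ) is the identity. [cite: Balaban1985BackgroundPropagators, Cor. 3.5 p.407, dictionary] -/
theorem dict_supp (lam : (geo9K i).Loc) (y : (geo9K i).Site) (h : (geo9K i).suppIn lam y) : (kGeoU i).suppIn lam y := h
/-- field `cutIn` is the identity. [cite: Balaban1985BackgroundPropagators, Cor. 3.5 p.407, dictionary] -/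
theorem dict_cutIn (ζ : (geo9K i).Cut) (y : (geo9K i).Site) (h : (geo9K i).cutIn ζ y) : (kGeoU i).cutIn ζ y := h
/-- field `cutT` (Δ̃ cut-offs ↦ [B6] cut-offs) is the identity: r03's cut-off class is already Δ̃-wide. [cite: Balaban1985BackgroundPropagators, (3.43), (3.45) p.398, dictionary] -/
theorem dict_cutT (ζ : (geo9K i).Cut) (y : (geo9K i).Site) (h : (geo9K i).cutInT ζ y) : (kGeoU i).cutIn ζ y := h
/-- the norm functionals agree: `supNorm`. [cite: Balaban1985BackgroundPropagators, (3.39) p.397, dictionary] -/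
theorem dict_supNorm_eq (lam : (geo9K i).Loc) : (kGeoU i).supNorm lam = (geo9K i).supNorm lam := rfl
/-- `l2Norm`. [cite: Balaban1985BackgroundPropagators, (3.46) p.398 («‖·‖»), dictionary] -/
theorem dict_l2Norm_eq (lam : (geo9K i).Loc) : (kGeoU i).l2Norm lam = (geo9K i).l2Norm lam := rfl
/-- `holder` (U = 1 Hölder functional at the scale ξ′). [cite: Balaban1985BackgroundPropagators, (3.40) p.397 (at U = 1), dictionary] -/
theorem dict_holder_eq (ε : ℝ) (lam : (geo9K i).Loc) : (kGeoU i).holder ε lam = (geo9K i).holder ε lam := rfl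
/-- `cutH`. [cite: Balaban1985BackgroundPropagators, (3.43) p.398 («‖ζ‖_β + |ζ|»), dictionary] -/
theorem dict_cutH_eq (b : ℝ) (ζ : (geo9K i).Cut) : (kGeoU i).cutH b ζ = (geo9K i).cutH b ζ := rfl
/-- `cutSup`. [cite: Balaban1985BackgroundPropagators, (3.46) p.398 («|h|»), dictionary] -/
theorem dict_cutSup_eq (h : (geo9K i).Cut) : (kGeoU i).cutSup h = (geo9K i).cutSup h := rfl
/-- field `suppT` (Δ̃-arguments ↦ [B6] arguments) IS an identity for the reading of record `geo9K` (one block on both sides).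
[cite: Balaban1985BackgroundPropagators, (3.44)–(3.45) p.398 (located reading)] -/
theorem dict_suppT (lam : (geo9K i).Loc) (y : (geo9K i).Site) (h : (geo9K i).suppInT lam y) : (kGeoU i).suppIn lam y := h

/-- **WHAT `suppT` NEEDS UNDER THE Δ̃ READING `geo9KT`** (R443 (c3) consumer rule, located): the field asks `suppNearU i lam y → (kGeoU i).suppIn lam y`,
which FAILS for any argument non-zero on a bond of a block adjacent to (and different from) `y` — so the Δ̃-faithful pin reads N03's (2.138)∕(2.139) slots
only after their Δ̃-extension; the contrapositive witness shape (block and bond are data):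
[cite: Balaban1985BackgroundPropagators, (3.44)–(3.45) p.398; Balaban1984PropagatorsII, (2.138)–(2.139) p.247 (supp J ⊂ Δ̃(y′))] -/
theorem not_suppIn_of_ne {J : PBond (PV d ℓ i.m i.K hd hL) 0 → ℝ} {y' : (geomT i.D).Site} {x : PBond (PV d ℓ i.m i.K hd hL) 0}
    (hx : J x ≠ 0) (hne : blkV1 i.hN i.D x ≠ y') : ¬ (kGeoG i).suppIn J y' :=
  fun h => hne (h x hx)

end Dict

/-! ## §5  Non-degeneracy of the predicates (∀-form over the data; no `∃` over free data) -/

section NonDeg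

variable (i : KIdx d ℓ hd hL b₀ b₁)

/-- the zero argument is Δ̃(y′)-supported for every `y′`. [cite: Balaban1985BackgroundPropagators, p.397 (Δ̃), bookkeeping] -/
theorem suppNear_zero (y' : (geomT i.D).Site) : suppNear i 0 y' := fun _ h => (h rfl).elim

/-- **`suppNear` is a genuine restriction**: a function non-zero on a bond whose block lies at torus distance `≥ 2` from `y′` is NOT Δ̃(y′)-supported.
[cite: Balaban1985BackgroundPropagators, p.397 (Δ̃(y) has size 2Lʲη), bookkeeping] -/
theorem not_suppNear_of_two_le_dist {J : PBond (PV d ℓ i.m i.K hd hL) 0 → ℝ} {y' : (geomT i.D).Site} {x : PBond (PV d ℓ i.m i.K hd hL) 0}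
    (hx : J x ≠ 0) (hfar : 2 ≤ (geomT i.D).dist (blkV1 i.hN i.D x) y') : ¬ suppNear i J y' := by
  intro h
  have := h x hx
  linarith

/-- the weighted norm of the zero function vanishes. [cite: Balaban1985BackgroundPropagators, (3.41) p.397, bookkeeping] -/
theorem wNormB_zero (γ : ℝ) : wNormB i γ (0 : PBond (PV d ℓ i.m i.K hd hL) 0 → ℝ) = 0 := by
  apply le_antisymm _ (wNormB_nonneg i γ 0)
  exact wNormB_le_of_pointwise i le_rfl fun x => by simp

/-- **the weighted norm SEES every bond**: a function with `|J|_{(γ)} = 0` vanishes identically (the weights are positive).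
[cite: Balaban1985BackgroundPropagators, (3.41) p.397, bookkeeping] -/
theorem eq_zero_of_wNormB_eq_zero {γ : ℝ} {J : PBond (PV d ℓ i.m i.K hd hL) 0 → ℝ} (h : wNormB i γ J = 0) : J = 0 := by
  funext x
  have hx := abs_le_of_wNormB_le i h.le x
  rw [zero_mul] at hx
  exact abs_nonpos_iff.mp hx

end NonDeg

/-! ## §6  The sign facts of the reading (the fields of `B9FromB6.ModelSigns` that HOLD for `geo9K`; `holder_mono` on the BOND summand) -/

section Signs

variable (i : KIdx d ℓ hd hL b₀ b₁)

/-- `0 ≤ L`. [cite: Balaban1985BackgroundPropagators, (3.41) p.397 («Lʲη»), bookkeeping] -/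
theorem geo9K_L_nonneg : 0 ≤ (geo9K i).L := by
  show (0 : ℝ) ≤ (((ℓ + 1 : ℕ) : ℝ)); positivity

/-- `0 ≤ η = |c_f|⁻¹`. [cite: Balaban1985BackgroundPropagators, (3.41) p.397, bookkeeping] -/
theorem geo9K_eta_nonneg : 0 ≤ (geo9K i).eta := by
  show (0 : ℝ) ≤ |i.cf|⁻¹; positivity

/-- `0 ≤ d(y, y′)`. [cite: Balaban1984PropagatorsII, (2.46) p.231, bookkeeping] -/
theorem geo9K_dist_nonneg (c c' : (geo9K i).Site) : 0 ≤ (geo9K i).dist c c' := by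
  show (0 : ℝ) ≤ (geomT i.D).dist _ _; exact Nat.cast_nonneg _

/-- `0 ≤ |λ|` (both summands). [cite: Balaban1985BackgroundPropagators, (3.39) p.397, bookkeeping] -/
theorem geo9K_supNorm_nonneg (lam : (geo9K i).Loc) : 0 ≤ (geo9K i).supNorm lam := by
  cases lam with
  | inl f => exact Real.iSup_nonneg fun _ => abs_nonneg _
  | inr J => exact Real.iSup_nonneg fun _ => abs_nonneg _

/-- `0 ≤ ‖λ‖` (both summands). [cite: Balaban1985BackgroundPropagators, (3.46) p.398 («‖·‖»), bookkeeping] -/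
theorem geo9K_l2Norm_nonneg (lam : (geo9K i).Loc) : 0 ≤ (geo9K i).l2Norm lam := by
  cases lam with
  | inl f => exact Real.sqrt_nonneg _
  | inr J => exact Real.sqrt_nonneg _

/-- `0 ≤ |λ|_{(γ)}` (both summands). [cite: Balaban1985BackgroundPropagators, (3.41) p.397, bookkeeping] -/
theorem geo9K_wNorm_nonneg (γ : ℝ) (lam : (geo9K i).Loc) : 0 ≤ (geo9K i).wNorm γ lam := wNormU_nonneg i γ lam

/-- `0 ≤ ‖λ‖_ε` (both summands: T8's `hqTP`, r03's admissible-pair functional). [cite: Balaban1985BackgroundPropagators, (3.40) p.397, bookkeeping] -/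
theorem geo9K_holder_nonneg (ε : ℝ) (lam : (geo9K i).Loc) : 0 ≤ (geo9K i).holder ε lam := by
  classical
  cases lam with
  | inl f => exact hqTP_nonneg (toKT i) ε f
  | inr J =>
      refine Real.iSup_nonneg fun q => ?_
      by_cases hq : B6KLevelCensusIndexV1.Adm i q.1 q.2
      · simp only [if_pos hq]
        exact mul_nonneg (Real.rpow_nonneg (B6KLevelCensusIndexV1.tpar_nonneg i _ _) _) (abs_nonneg _)
      · simp only [if_neg hq]; exact le_rfl

/-- `0 ≤ ‖ζ‖_β + |ζ|` (both summands). [cite: Balaban1985BackgroundPropagators, (3.43) p.398, bookkeeping] -/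
theorem geo9K_cutH_nonneg (b : ℝ) (ζ : (geo9K i).Cut) : 0 ≤ (geo9K i).cutH b ζ := by
  classical
  cases ζ with
  | inl z => exact add_nonneg (hqTP_nonneg (toKT i) b z) (Real.iSup_nonneg fun _ => abs_nonneg _)
  | inr z =>
      refine add_nonneg (Real.iSup_nonneg fun _ => abs_nonneg _) (Real.iSup_nonneg fun q => ?_)
      by_cases hq : B6KLevelCensusIndexV1.Adm i q.1 q.2
      · simp only [if_pos hq]
        exact mul_nonneg (Real.rpow_nonneg (B6KLevelCensusIndexV1.tpar_nonneg i _ _) _) (abs_nonneg _)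
      · simp only [if_neg hq]; exact le_rfl

/-- `0 ≤ |h|` (both summands). [cite: Balaban1985BackgroundPropagators, (3.46) p.398 («|h|»), bookkeeping] -/
theorem geo9K_cutSup_nonneg (h : (geo9K i).Cut) : 0 ≤ (geo9K i).cutSup h := by
  cases h with
  | inl z => exact Real.iSup_nonneg fun _ => abs_nonneg _
  | inr z => exact Real.iSup_nonneg fun _ => abs_nonneg _

/-- **`‖J‖_ε ≤ ‖J‖_{ε′}` for `ε ≤ ε′` ON THE FINE-BOND SUMMAND** (r03's `holder_mono_exponent`: the quotient parameter `t ≤ 1` on admissible pairs) — the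
G-B9-13 range repair of `B9FromB6.ModelSigns.holder_mono` for the arguments of G = Δ_a⁻¹.  (On the SITE summand T8's all-pairs `hqTP` is NOT monotone in
the exponent — seat note [N03B-G2-HAZARD-1]; print's (3.40) takes `|x − x′| ≤ 1` only.) [cite: Balaban1985BackgroundPropagators, (3.40) p.397, (3.44)–(3.45) p.398] -/
theorem geo9K_holder_mono_bond {ε ε' : ℝ} (hεε : ε ≤ ε') (J : PBond (PV d ℓ i.m i.K hd hL) 0 → ℝ) :
    (geo9K i).holder ε (Sum.inr J) ≤ (geo9K i).holder ε' (Sum.inr J) :=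
  holder_mono_exponent i hεε J

end Signs

end Literature.MathematicalPhysics.QuantumFieldTheory.Balaban1983to89.B9GeoNormsKLevelV1

end
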